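import Mathlib
import HarnessLib

/-!
# Gordan's theorem of the alternative

Topic `Combinatorics/Optimization`; theorems only. Over a linearly ordered field `𝕜`, for a finite
family of vectors `f_a ∈ 𝕜^r` exactly one of the following holds (we prove the disjunction, which
is what is used; exclusivity is the trivial direction):

* (I) there is `h ∈ 𝕜^r` with `⟨h, f_a⟩ > 0` for every `a`;
* (II) there are coefficients `c_a ≥ 0`, not all zero, with `Σ_a c_a f_a = 0`.

`gordan` is proved by Fourier–Motzkin elimination of the last coordinate (induction on `r`):
split the family by the sign of the last coordinate; the reduced family consists of the vectors
with last coordinate zero and of the normalised sums `f_p/ℓ_p + f_n/(-ℓ_n)` over pairs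
(positive, negative); a solution of the reduced strict system extends by choosing the last
coordinate of `h` strictly between the bounds coming from the two signs, and a nonnegative
relation of the reduced family unfolds to one of the original family.

`gordan_int` is the integral form: for integer vectors, either an INTEGER `h` with all
`⟨h, f_a⟩ > 0`, or natural coefficients, not all zero, with `Σ c_a f_a = 0`.

Consumer: sign patterns of finitely many elements of a totally ordered abelian group are realised
by `ℤ`-valued homomorphisms (value-group bookkeeping in the valuative proof of the
Hilbert–Mumford criterion, item `HilbertMumfordHalf` of route MatrixMultiplication/ToricBorderRank).

## References

* P. Gordan, *Über die Auflösung linearer Gleichungen mit reellen Coefficienten*, Math. Ann. 6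
  (1873) 23–28; A. Schrijver, *Theory of Linear and Integer Programming*, Wiley 1986, §7.3
  (Fourier–Motzkin elimination) and Cor. 7.1e; folklore form.
-/

open Finset

namespace Literature.Combinatorics.Optimization

variable {𝕜 : Type*} [Field 𝕜] [LinearOrder 𝕜] [IsStrictOrderedRing 𝕜]

/-- **Gordan's theorem of the alternative** (Fourier–Motzkin): for a finite family `f_a ∈ 𝕜^r`
over a linearly ordered field, either some `h` has `⟨h, f_a⟩ > 0` for all `a`, or there is a
nonnegative, not identically zero, vanishing combination `Σ c_a f_a = 0`. [folklore] -/
theorem gordan : ∀ (r : ℕ) {α : Type*} [Fintype α] (f : α → Fin r → 𝕜),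
    (∃ h : Fin r → 𝕜, ∀ a, 0 < ∑ i, h i * f a i) ∨
    (∃ c : α → 𝕜, (∀ a, 0 ≤ c a) ∧ (∃ a, 0 < c a) ∧ ∀ i, ∑ a, c a * f a i = 0) := by
  intro r
  induction r with
  | zero =>
    intro α _ f
    rcases isEmpty_or_nonempty α with hα | ⟨⟨a₀⟩⟩
    · exact Or.inl ⟨0, fun a => (IsEmpty.false a).elim⟩
    · exact Or.inr ⟨fun _ => 1, fun _ => zero_le_one, ⟨a₀, zero_lt_one⟩, fun i => i.elim0⟩
  | succ r ih =>
    intro α _ f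
    classical
    -- the last coordinate and the three sign classes
    set ℓ : α → 𝕜 := fun a => f a (Fin.last r) with hℓ
    set Z := {a // ℓ a = 0} with hZ
    set P := {a // 0 < ℓ a} with hP
    set N := {a // ℓ a < 0} with hN
    -- the reduced family: last-coordinate-zero vectors and normalised sums over pairs
    set lift : Z ⊕ P × N → Fin (r + 1) → 𝕜 := fun b => match b with
      | Sum.inl z => f z
      | Sum.inr (p, n) => fun i => f p i / ℓ p + f n i / (-ℓ n) with hlift
    have hlift_last : ∀ b, lift b (Fin.last r) = 0 := by
      rintro (z | ⟨p, n⟩)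
      · exact z.2
      · show f p (Fin.last r) / ℓ p + f n (Fin.last r) / (-ℓ n) = 0
        have hp : ℓ p ≠ 0 := ne_of_gt p.2
        have hn : -ℓ n ≠ 0 := by have := n.2; intro h; linarith
        rw [show f p (Fin.last r) = ℓ p from rfl, show f n (Fin.last r) = ℓ n from rfl,
          div_self hp, div_neg, div_self (ne_of_lt n.2), add_neg_cancel]
    set g : Z ⊕ P × N → Fin r → 𝕜 := fun b i => lift b (Fin.castSucc i) with hg
    rcases ih g with ⟨h', hh'⟩ | ⟨c', hc'0, ⟨b₀, hb₀⟩, hc'sum⟩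
    · -- (I) for the reduced family: extend `h'` by a suitable last coordinate `t`
      set u : P → 𝕜 := fun p => ∑ i, h' i * f p (Fin.castSucc i) / ℓ p with hu
      set w : N → 𝕜 := fun n => ∑ i, h' i * f n (Fin.castSucc i) / (-ℓ n) with hw
      have hpair : ∀ p n, -u p < w n := by
        intro p n
        have := hh' (Sum.inr (p, n))
        simp only [hg, hlift] at this
        have e : ∑ i, h' i * (f p (Fin.castSucc i) / ℓ p + f n (Fin.castSucc i) / (-ℓ n)) =
            u p + w n := by
          simp only [hu, hw, mul_add, Finset.sum_add_distrib, mul_div_assoc]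
        linarith [e ▸ this]
      -- the choice of `t`
      obtain ⟨t, htP, htN⟩ : ∃ t : 𝕜, (∀ p, -u p < t) ∧ (∀ n, t < w n) := by
        rcases isEmpty_or_nonempty P with hPe | hPn
        · rcases isEmpty_or_nonempty N with hNe | hNn
          · exact ⟨0, fun p => (IsEmpty.false p).elim, fun n => (IsEmpty.false n).elim⟩
          · refine ⟨(Finset.univ.image w).min' (by simp) - 1, fun p => (IsEmpty.false p).elim,
              fun n => ?_⟩
            have := Finset.min'_le (Finset.univ.image w) (w n) (by simp)
            linarith
        · rcases isEmpty_or_nonempty N with hNe | hNn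
          · refine ⟨(Finset.univ.image fun p => -u p).max' (by simp) + 1, fun p => ?_,
              fun n => (IsEmpty.false n).elim⟩
            have := Finset.le_max' (Finset.univ.image fun p => -u p) (-u p) (by simp)
            linarith
          · set lo := (Finset.univ.image fun p => -u p).max' (by simp) with hlo
            set hi := (Finset.univ.image w).min' (by simp) with hhi
            have hlohi : lo < hi := by
              obtain ⟨p₀, -, hp₀⟩ := Finset.mem_image.mp
                (Finset.max'_mem (Finset.univ.image fun p => -u p) (by simp))
              obtain ⟨n₀, -, hn₀⟩ := Finset.mem_image.mp
                (Finset.min'_mem (Finset.univ.image w) (by simp))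
              rw [hlo, ← hp₀, hhi, ← hn₀]
              exact hpair p₀ n₀
            refine ⟨(lo + hi) / 2, fun p => ?_, fun n => ?_⟩
            · have := Finset.le_max' (Finset.univ.image fun p => -u p) (-u p) (by simp)
              rw [← hlo] at this
              linarith
            · have := Finset.min'_le (Finset.univ.image w) (w n) (by simp)
              rw [← hhi] at this
              linarith
      refine Or.inl ⟨Fin.snoc h' t, fun a => ?_⟩
      rw [Fin.sum_univ_castSucc]
      simp only [Fin.snoc_castSucc, Fin.snoc_last]
      rcases lt_trichotomy (ℓ a) 0 with hneg | hzero | hpos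
      · have hℓa : ℓ a ≠ 0 := ne_of_lt hneg
        have e : ∑ i : Fin r, h' i * f a (Fin.castSucc i) = (-ℓ a) * w ⟨a, hneg⟩ := by
          simp only [hw, Finset.mul_sum]
          refine Finset.sum_congr rfl fun i _ => ?_
          field_simp
        rw [e, show f a (Fin.last r) = ℓ a from rfl]
        have := htN ⟨a, hneg⟩
        nlinarith
      · have := hh' (Sum.inl ⟨a, hzero⟩)
        simp only [hg, hlift] at this
        rw [show f a (Fin.last r) = ℓ a from rfl, hzero, mul_zero, add_zero]
        exact this
      · have hℓa : ℓ a ≠ 0 := ne_of_gt hpos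
        have e : ∑ i : Fin r, h' i * f a (Fin.castSucc i) = ℓ a * u ⟨a, hpos⟩ := by
          simp only [hu, Finset.mul_sum]
          refine Finset.sum_congr rfl fun i _ => ?_
          field_simp
        rw [e, show f a (Fin.last r) = ℓ a from rfl]
        have := htP ⟨a, hpos⟩
        nlinarith
    · -- (II) for the reduced family unfolds to (II) for `f`
      set coeff : Z ⊕ P × N → α → 𝕜 := fun b a => match b with
        | Sum.inl z => if (z : α) = a then 1 else 0
        | Sum.inr (p, n) => (if (p : α) = a then 1 / ℓ p else 0) + (if (n : α) = a then 1 / (-ℓ n) else 0)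
        with hcoeff
      have hcoeff0 : ∀ b a, 0 ≤ coeff b a := by
        rintro (z | ⟨p, n⟩) a
        · simp only [hcoeff]; split_ifs <;> norm_num
        · simp only [hcoeff]
          have hp : 0 ≤ 1 / ℓ p := le_of_lt (one_div_pos.mpr p.2)
          have hn : 0 ≤ 1 / (-ℓ n) := le_of_lt (one_div_pos.mpr (by have := n.2; linarith))
          split_ifs <;> linarith
      have hcoeff_sum : ∀ b i, ∑ a, coeff b a * f a i = lift b i := by
        rintro (z | ⟨p, n⟩) i
        · simp [hcoeff, hlift, Finset.sum_ite_eq, ite_mul]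
        · simp only [hcoeff, hlift, add_mul, Finset.sum_add_distrib, ite_mul, zero_mul,
            Finset.sum_ite_eq, Finset.mem_univ, if_true]
          ring
      refine Or.inr ⟨fun a => ∑ b, c' b * coeff b a, fun a => Finset.sum_nonneg fun b _ =>
        mul_nonneg (hc'0 b) (hcoeff0 b a), ?_, fun i => ?_⟩
      · -- positivity at a preimage of `b₀`
        have key : ∀ a, c' b₀ * coeff b₀ a ≤ ∑ b, c' b * coeff b a := fun a =>
          Finset.single_le_sum (f := fun b => c' b * coeff b a)
            (fun b _ => mul_nonneg (hc'0 b) (hcoeff0 b a)) (Finset.mem_univ b₀)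
        rcases hb : b₀ with z | ⟨p, n⟩
        · refine ⟨z, lt_of_lt_of_le ?_ (key z)⟩
          rw [hb]
          simp only [hcoeff, if_true, mul_one]
          exact hb ▸ hb₀
        · refine ⟨p, lt_of_lt_of_le ?_ (key p)⟩
          rw [hb]
          simp only [hcoeff, if_true]
          have h1 : 0 < 1 / ℓ p := one_div_pos.mpr p.2
          have h2 : 0 ≤ (if ((n : α)) = (p : α) then 1 / (-ℓ n) else 0) := by
            split_ifs
            · exact le_of_lt (one_div_pos.mpr (by have := n.2; linarith))
            · exact le_rfl
          have h3 : 0 < c' (Sum.inr (p, n)) := hb ▸ hb₀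
          nlinarith
      · -- the relation
        have e : ∑ a, (∑ b, c' b * coeff b a) * f a i = ∑ b, c' b * lift b i := by
          simp only [Finset.sum_mul]
          rw [Finset.sum_comm]
          refine Finset.sum_congr rfl fun b _ => ?_
          simp only [mul_assoc, ← Finset.mul_sum, hcoeff_sum]
        rw [e]
        refine Fin.lastCases ?_ (fun i' => ?_) i
        · simp [hlift_last]
        · have := hc'sum i'
          simpa only [hg] using this

/-- **Gordan's theorem, integral form**: for a finite family of integer vectors, either an integer
`h` with `⟨h, f_a⟩ > 0` for all `a`, or natural coefficients, not all zero, with `Σ c_a f_a = 0`.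
[folklore] -/
theorem gordan_int (r : ℕ) {α : Type*} [Fintype α] (f : α → Fin r → ℤ) :
    (∃ h : Fin r → ℤ, ∀ a, 0 < ∑ i, h i * f a i) ∨
    (∃ c : α → ℕ, (∃ a, 0 < c a) ∧ ∀ i, ∑ a, (c a : ℤ) * f a i = 0) := by
  classical
  rcases gordan (𝕜 := ℚ) r (fun a i => (f a i : ℚ)) with ⟨h, hh⟩ | ⟨c, hc0, ⟨a₀, ha₀⟩, hcsum⟩
  · -- clear denominators of `h`
    obtain ⟨D, hDpos, hD⟩ : ∃ D : ℤ, 0 < D ∧ ∀ i, ∃ m : ℤ, h i * D = m := by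
      refine ⟨∏ i, (h i).den, ?_, fun i => ?_⟩
      · exact_mod_cast Finset.prod_pos fun i _ => (h i).den_pos
      · have hdvd : ((h i).den : ℤ) ∣ ∏ j, ((h j).den : ℤ) :=
          Finset.dvd_prod_of_mem (fun j => ((h j).den : ℤ)) (Finset.mem_univ i)
        obtain ⟨k, hk⟩ := hdvd
        refine ⟨(h i).num * k, ?_⟩
        have hk' : (∏ j, ((h j).den : ℚ)) = ((h i).den : ℚ) * (k : ℚ) := by exact_mod_cast hk
        push_cast
        rw [hk', ← mul_assoc, Rat.mul_den_eq_num]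
    choose m hm using hD
    refine Or.inl ⟨m, fun a => ?_⟩
    have hq : (0 : ℚ) < ∑ i, (m i : ℚ) * f a i := by
      have e : ∑ i, (m i : ℚ) * f a i = (∑ i, h i * f a i) * D := by
        rw [Finset.sum_mul]
        refine Finset.sum_congr rfl fun i _ => ?_
        rw [← hm i]; ring
      rw [e]
      exact mul_pos (hh a) (by exact_mod_cast hDpos)
    exact_mod_cast hq
  · -- clear denominators of `c` and pass to `ℕ`
    obtain ⟨D, hDpos, hD⟩ : ∃ D : ℤ, 0 < D ∧ ∀ a, ∃ m : ℤ, c a * D = m := by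
      refine ⟨∏ a, (c a).den, ?_, fun a => ?_⟩
      · exact_mod_cast Finset.prod_pos fun a _ => (c a).den_pos
      · have hdvd : ((c a).den : ℤ) ∣ ∏ b, ((c b).den : ℤ) :=
          Finset.dvd_prod_of_mem (fun b => ((c b).den : ℤ)) (Finset.mem_univ a)
        obtain ⟨k, hk⟩ := hdvd
        refine ⟨(c a).num * k, ?_⟩
        have hk' : (∏ b, ((c b).den : ℚ)) = ((c a).den : ℚ) * (k : ℚ) := by exact_mod_cast hk
        push_cast
        rw [hk', ← mul_assoc, Rat.mul_den_eq_num]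
    choose m hm using hD
    have hm0 : ∀ a, 0 ≤ m a := fun a => by
      have : (0 : ℚ) ≤ m a := by rw [← hm a]; exact mul_nonneg (hc0 a) (by exact_mod_cast hDpos.le)
      exact_mod_cast this
    refine Or.inr ⟨fun a => (m a).toNat, ⟨a₀, ?_⟩, fun i => ?_⟩
    · have : (0 : ℚ) < m a₀ := by rw [← hm a₀]; exact mul_pos ha₀ (by exact_mod_cast hDpos)
      have h1 : (0 : ℤ) < m a₀ := by exact_mod_cast this
      show 0 < (m a₀).toNat
      rw [Int.lt_toNat]
      simpa using h1
    · have hq : ∑ a, (m a : ℚ) * f a i = 0 := by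
        have e : ∑ a, (m a : ℚ) * f a i = (∑ a, c a * f a i) * D := by
          rw [Finset.sum_mul]
          refine Finset.sum_congr rfl fun a _ => ?_
          rw [← hm a]; ring
        rw [e, hcsum i, zero_mul]
      have hz : ∑ a, m a * f a i = 0 := by exact_mod_cast hq
      rw [← hz]
      refine Finset.sum_congr rfl fun a _ => ?_
      rw [Int.toNat_of_nonneg (hm0 a)]

end Literature.Combinatorics.Optimization
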